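import Summits.ABC.IUTFork.Repair.RHTieDeciderSqrtNegOne
import Literature.IUT.LogVolume.GenuineThetaFieldCyclotomicRamification
import Mathlib.NumberTheory.NumberField.Ideal.Basic
import HarnessLib

/-!
# D-0079 RESCUE sub-cell R-H, TIE-DECIDER lane: roots of unity of `K` force `n ∣ p^{f(𝔭∣p)} − 1` — at a genuine Θ-volume
# datum (`μ₄·μ₃·μ₅ ⊂ K`) a place of residue degree `1` lies over `p ≡ 1 (mod 60)` ONLY; else `f(𝔭∣p) ≥ 2`

PROOF-ONLY file (0 definitions, 0 `Prop` facts; abc-iut cell, D-0079 RESCUE sub-cell R-H, rung LADDER-ABC:A2.RESCUE.H; seat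
abc-iut-rh-typ-12 gen 5, TIE-DECIDER lane). TAKES NO SIDE on [IUTchIII] Cor. 3.12 or on any author; every R-H candidate (row 27's
`HStarReachLedgerK` / `LedgerAtDatum`) stays a HYPOTHESIS; typed ≠ proved; nothing here asserts abc proved or refuted.

Sequel of `Repair/RHTieDeciderSqrtNegOne.lean` (p485594: `√−1 ∈ K` ⇒ `2 ∣ f(𝔭∣p)` at `p ≡ 3 (mod 4)`). THE GENERAL LAW (classical:
a primitive `n`-th root of unity `ζ ∈ 𝓞_K` stays primitive in `𝓞_K/𝔭` when `gcd(𝐍𝔭, n) = 1` — Mathlib `IsPrimitiveRoot.idealQuotient_mk`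
— so its image has order `n` in `(𝓞_K/𝔭)^×`, a group of order `𝐍𝔭 − 1 = p^{f(𝔭∣p)} − 1`):
* §0 `dvd_absNorm_sub_one_of_isPrimitiveRoot_of_coprime` — `ζ_n ∈ K`, `gcd(𝐍𝔭, n) = 1` ⇒ `n ∣ 𝐍𝔭 − 1`;
  **`dvd_pow_inertiaDeg_sub_one_of_isPrimitiveRoot`** — `ζ_n ∈ K`, `p ∤ n`, `𝔭 ∣ p` ⇒ `n ∣ p^{f(𝔭∣p)} − 1`.
* §1 arithmetic: `two_dvd_of_three_dvd_pow_sub_one` (`p ≡ 2 (mod 3)`), `two_dvd_of_five_dvd_pow_sub_one` (`p ≡ 4 (mod 5)`),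
  `four_dvd_of_five_dvd_pow_sub_one` (`p ≡ 2, 3 (mod 5)`), `mod_sixty_eq_one` (CRT assembly).
* §2 AT A GENUINE Θ-VOLUME DATUM `T : Cor22.ThetaVolumeDatumAt P l` (`X := pilotDataOfK T.D T.K`): `ζ_3, ζ_5 ∈ F ⊆ K`
  (`ThetaVolumeDatumAt.exists_isPrimitiveRoot_F`: the `30`-torsion of `E_F` is `F`-rational, [IUTchIV] Thm. 1.10, + Weil pairing) and
  `√−1 ∈ K` ([IUTchI] Def. 3.1 (a)); hence `ThetaVolumeDatumAt.three_dvd_pow_inertiaDeg_sub_one` / `…five_dvd…`, and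
  **`ThetaVolumeDatumAt.two_dvd_inertiaDeg_placeOf_of_mod_sixty_ne_one`**: for EVERY prime `p ≢ 1 (mod 60)` and every fibre point
  `x` over `p`: `2 ∣ f(𝔭_x∣p)` and `f(𝔭_x∣p) ≥ 2` (`4 ∣ f` when `p ≡ 2, 3 (mod 5)`: `…four_dvd_inertiaDeg_placeOf_of_mod_five`);
  contrapositive **`ThetaVolumeDatumAt.mod_sixty_eq_one_of_inertiaDeg_eq_one`**: a place of `K` of residue degree `1` lies over
  `p ≡ 1 (mod 60)`. The (O″)-supplier of the row-27 door at every `p ≢ 1 (mod 60)`: **`ThetaVolumeDatumAt.outerUnit_clause_of_mod_sixty_ne_one`**.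
So the kernel-exact residual of row 27's certificate binder (after p483260 / p485594 / p485816) is: a bad prime `p ≡ 1 (mod 60)` of
cyclotomic index `e_p = p^a(p−1)` carrying a residue-degree-`1` place of cyclotomic type; TABLE CONSEQUENCE for the numerics seats: on the
genuine bed every column «`f = 1`» (or odd `f`, or odd local degree `e·f` with `e` odd) at a prime `p ≢ 1 (mod 60)` contradicts the typed datum.
HONEST SCOPE: classical algebra + the tree's typed genuine datum; no numerics.
[cite: NeukirchANT1999, Ch. I §8, §10 (10.3)] [cite: Washington1997, Lemma 1.4, Prop. 2.1, Thm. 2.13] [cite: IrelandRosen1990, Ch. 7 §1 Thm. 1]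
[cite: SilvermanAEC2009, Cor. III.8.1.1] [cite: Mochizuki2012, IUTchI Def. 3.1 (a),(b) p. 61; IUTchIV Thm. 1.10 p. 22] [claim: Mochizuki2012, status: disputed]
-/

noncomputable section

open Set Function NumberField IsDedekindDomain

namespace Summit.ABC.IUTFork.Repair.RH.TieDecider

open Thm311 Thm311.Real Cor312 Cor312Vol Cor312Prov Literature.IUT.LogThetaLattice Literature.IUT.LogVolume
  Literature.IUT.HodgeTheaters Summit.ABC.IUTFork.Repair.RH.ReachLedger Summit.ABC.IUTFork.Repair.RH.ReachLedgerDoor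
open Literature.NumberTheory.NumberFields
open Literature.NumberTheory.GaloisRepresentations.Ultrametric

/-! ## §0. `ζ_n ∈ K` and `p ∤ n` ⇒ `n ∣ p^{f(𝔭∣p)} − 1` -/

section NumberFields

variable {K : Type} [Field K] [NumberField K]

/-- **A primitive `n`-th root of unity of `K` forces `n ∣ 𝐍𝔭 − 1`** at every maximal `𝔭 ⊂ 𝓞_K` with `gcd(𝐍𝔭, n) = 1`: its image in
`𝓞_K/𝔭` is still primitive (Mathlib `IsPrimitiveRoot.idealQuotient_mk`), so of order `n` in the unit group of the residue field, which
has `𝐍𝔭 − 1` elements. (General-order form; the prime-order case `v ∤ p` is the tree's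
`Literature.NumberTheory.NumberFields.dvd_absNorm_sub_one_of_isPrimitiveRoot`, ThainePrimes.) [cite: NeukirchANT1999, Ch. I §10 (10.3)]
[cite: Washington1997, Lemma 1.4, Thm. 2.13] -/
theorem dvd_absNorm_sub_one_of_isPrimitiveRoot_of_coprime {n : ℕ} [NeZero n] {ζ : K} (hζ : IsPrimitiveRoot ζ n)
    {P : Ideal (𝓞 K)} [hP : P.IsMaximal] (hcop : (Ideal.absNorm P).Coprime n) : n ∣ Ideal.absNorm P - 1 := by
  letI : Field (𝓞 K ⧸ P) := Ideal.Quotient.field P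
  have hP1 : Ideal.absNorm P ≠ 1 := Ideal.absNorm_eq_one_iff.not.mpr hP.ne_top
  have hζ' : IsPrimitiveRoot (Ideal.Quotient.mk P hζ.toInteger) n :=
    hζ.toInteger_isPrimitiveRoot.idealQuotient_mk hP1 hcop
  obtain ⟨u, hu⟩ := hζ'.isUnit (NeZero.ne n)
  rw [← hu] at hζ'
  have hu' : IsPrimitiveRoot u n := IsPrimitiveRoot.coe_units_iff.mp hζ'
  have hdvd : n ∣ Nat.card (𝓞 K ⧸ P)ˣ := by
    rw [hu'.eq_orderOf]
    exact orderOf_dvd_natCard u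
  have hN : Ideal.absNorm P = Nat.card (𝓞 K ⧸ P) := by
    rw [Ideal.absNorm_apply, Submodule.cardQuot_apply]
  rwa [Nat.card_units, ← hN] at hdvd

/-- **`ζ_n ∈ K`, `p ∤ n`, `𝔭 ∣ p` ⇒ `n ∣ p^{f(𝔭∣p)} − 1`** (`𝐍𝔭 = p^{f(𝔭∣p)}`). [cite: NeukirchANT1999, Ch. I §8, §10 (10.3)]
[cite: Washington1997, Thm. 2.13] -/
theorem dvd_pow_inertiaDeg_sub_one_of_isPrimitiveRoot {n : ℕ} [NeZero n] {ζ : K} (hζ : IsPrimitiveRoot ζ n) (p : ℕ)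
    [hp : Fact p.Prime] (hpn : p.Coprime n) (v : HeightOneSpectrum (𝓞 K)) (hv : ((p : ℕ) : 𝓞 K) ∈ v.asIdeal) :
    n ∣ p ^ v.asIdeal.inertiaDeg ℤ - 1 := by
  haveI : v.asIdeal.IsMaximal := v.isMaximal
  have hN := absNorm_eq_pow_inertiaDeg K p v hv
  have h := dvd_absNorm_sub_one_of_isPrimitiveRoot_of_coprime hζ (P := v.asIdeal) (by rw [hN]; exact hpn.pow_left _)
  rwa [hN] at h

end NumberFields

/-! ## §1. Arithmetic: parity of `f` from `n ∣ p^f − 1`, `n ∈ {3, 4, 5}` -/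

section Arith

/-- `p ≡ 2 (mod 3)` and `3 ∣ p^f − 1` ⇒ `f` even (`p` has order `2` mod `3`). [folklore] -/
theorem two_dvd_of_three_dvd_pow_sub_one {p f : ℕ} (hp : p % 3 = 2) (h : 3 ∣ p ^ f - 1) : 2 ∣ f := by
  by_contra hodd
  obtain ⟨m, rfl⟩ : Odd f := Nat.odd_iff.mpr (Nat.two_dvd_ne_zero.mp hodd)
  have h2 : p ^ 2 % 3 = 1 := by rw [Nat.pow_mod, hp]
  have h2m : (p ^ 2) ^ m % 3 = 1 := by rw [Nat.pow_mod, h2, one_pow]; norm_num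
  have hf : p ^ (2 * m + 1) % 3 = 2 := by rw [pow_succ, pow_mul, Nat.mul_mod, h2m, hp]
  have h1 : 1 ≤ p ^ (2 * m + 1) := Nat.one_le_pow _ _ (by omega)
  omega

/-- `p ≡ 3 (mod 4)` and `4 ∣ p^f − 1` ⇒ `f` even. [folklore] -/
theorem two_dvd_of_four_dvd_pow_sub_one {p f : ℕ} (hp : p % 4 = 3) (h : 4 ∣ p ^ f - 1) : 2 ∣ f := by
  by_contra hodd
  have hodd' : Odd f := Nat.odd_iff.mpr (Nat.two_dvd_ne_zero.mp hodd)
  have hf := pow_mod_four_eq_three_of_odd hp hodd'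
  have h1 : 1 ≤ p ^ f := Nat.one_le_pow _ _ (by omega)
  omega

/-- `p ≡ 4 (mod 5)` and `5 ∣ p^f − 1` ⇒ `f` even (`p` has order `2` mod `5`). [folklore] -/
theorem two_dvd_of_five_dvd_pow_sub_one {p f : ℕ} (hp : p % 5 = 4) (h : 5 ∣ p ^ f - 1) : 2 ∣ f := by
  by_contra hodd
  obtain ⟨m, rfl⟩ : Odd f := Nat.odd_iff.mpr (Nat.two_dvd_ne_zero.mp hodd)
  have h2 : p ^ 2 % 5 = 1 := by rw [Nat.pow_mod, hp]
  have h2m : (p ^ 2) ^ m % 5 = 1 := by rw [Nat.pow_mod, h2, one_pow]; norm_num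
  have hf : p ^ (2 * m + 1) % 5 = 4 := by rw [pow_succ, pow_mul, Nat.mul_mod, h2m, hp]
  have h1 : 1 ≤ p ^ (2 * m + 1) := Nat.one_le_pow _ _ (by omega)
  omega

/-- `p ≡ 2` or `3 (mod 5)` and `5 ∣ p^f − 1` ⇒ `4 ∣ f` (`p` has order `4` mod `5`). [folklore] -/
theorem four_dvd_of_five_dvd_pow_sub_one {p f : ℕ} (hp : p % 5 = 2 ∨ p % 5 = 3) (h : 5 ∣ p ^ f - 1) : 4 ∣ f := by
  have h4 : p ^ 4 % 5 = 1 := by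
    rcases hp with hp | hp <;> rw [Nat.pow_mod, hp]
  have h4m : (p ^ 4) ^ (f / 4) % 5 = 1 := by rw [Nat.pow_mod, h4, one_pow]; norm_num
  have hdecomp : p ^ f = (p ^ 4) ^ (f / 4) * p ^ (f % 4) := by
    rw [← pow_mul, ← pow_add, Nat.div_add_mod]
  have hf : p ^ f % 5 = p ^ (f % 4) % 5 := by rw [hdecomp, Nat.mul_mod, h4m, one_mul, Nat.mod_mod]
  have h1 : 1 ≤ p ^ f := Nat.one_le_pow _ _ (by omega)
  have hres : p ^ (f % 4) % 5 = 1 := by omega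
  have hlt : f % 4 < 4 := Nat.mod_lt _ (by norm_num)
  by_contra hnd
  have hne : f % 4 ≠ 0 := fun h0 => hnd (Nat.dvd_of_mod_eq_zero h0)
  interval_cases hr : f % 4
  · exact hne rfl
  · rw [pow_one] at hres; omega
  · rw [Nat.pow_mod] at hres; rcases hp with hp | hp <;> rw [hp] at hres <;> norm_num at hres
  · rw [Nat.pow_mod] at hres; rcases hp with hp | hp <;> rw [hp] at hres <;> norm_num at hres

/-- CRT assembly: `p ≡ 1 (mod 4)`, `p ≡ 1 (mod 3)`, `p ≡ 1 (mod 5)` ⇒ `p ≡ 1 (mod 60)`. [folklore] -/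
theorem mod_sixty_eq_one {p : ℕ} (h4 : p % 4 = 1) (h3 : p % 3 = 1) (h5 : p % 5 = 1) : p % 60 = 1 := by
  omega

/-- A prime `p ≢ 1 (mod 60)` has `p % 4 = 3`, or `p % 3 = 2`, or `p % 5 ∈ {2, 3, 4}` (the primes `2, 3, 5` included). [folklore] -/
theorem prime_mod_cases {p : ℕ} (hp : p.Prime) (h60 : p % 60 ≠ 1) :
    p % 4 = 3 ∨ p % 3 = 2 ∨ p % 5 = 4 ∨ (p % 5 = 2 ∨ p % 5 = 3) := by
  have h2 := hp.two_le
  by_cases hp2 : p = 2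
  · subst hp2; decide
  by_cases hp3 : p = 3
  · subst hp3; decide
  by_cases hp5 : p = 5
  · subst hp5; decide
  have hodd : ¬ 2 ∣ p := fun hd => hp2 ((hp.eq_one_or_self_of_dvd 2 hd).resolve_left (by norm_num)).symm
  have hn3 : p % 3 ≠ 0 := fun h => hp3 ((hp.eq_one_or_self_of_dvd 3 (Nat.dvd_of_mod_eq_zero h)).resolve_left (by norm_num)).symm
  have hn5 : p % 5 ≠ 0 := fun h => hp5 ((hp.eq_one_or_self_of_dvd 5 (Nat.dvd_of_mod_eq_zero h)).resolve_left (by norm_num)).symm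
  omega

end Arith

/-! ## §2. The genuine Θ-volume datum: `μ₆₀ ⊂ K`, so `f(𝔭∣p) = 1` only over `p ≡ 1 (mod 60)` -/

section Datum

open Literature.IUT.LogVolume.Cor22 Literature.NumberTheory.DiophantineGeometry.GenEll

variable {P : NFPoint} {l : ℕ} (T : ThetaVolumeDatumAt P l)

/-- **`ζ_p ∈ K` for every prime `p ∣ 30`** at a genuine Θ-volume datum (`ζ_p ∈ F`: [IUTchIV] Thm. 1.10 rational `30`-torsion + Weil
pairing, `ThetaVolumeDatumAt.exists_isPrimitiveRoot_F`; pushed along `F → K`). [cite: Mochizuki2012, IUTchIV Thm. 1.10 p. 22]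
[cite: SilvermanAEC2009, Cor. III.8.1.1] [claim: Mochizuki2012, status: disputed] -/
theorem _root_.Literature.IUT.LogVolume.Cor22.ThetaVolumeDatumAt.exists_isPrimitiveRoot_K {p : ℕ} (hp : p.Prime)
    (hp30 : p ∣ 30) :
    letI := T.instFieldF; letI := T.instFieldK; letI := T.instAlgebraK
    ∃ ζ : T.K, IsPrimitiveRoot ζ p := by
  letI := T.instFieldF; letI := T.instNumberFieldF; letI := T.instFieldK; letI := T.instAlgebraK; letI := T.instIsElliptic
  obtain ⟨ζ, hζ⟩ := T.exists_isPrimitiveRoot_F hp hp30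
  exact ⟨algebraMap T.F T.K ζ, hζ.map_of_injective (algebraMap T.F T.K).injective⟩

/-- **`3 ∣ p^{f(𝔭∣p)} − 1` at every place of `K` over a prime `p ≠ 3`** (`ζ_3 ∈ K`). [cite: Washington1997, Thm. 2.13]
[cite: Mochizuki2012, IUTchIV Thm. 1.10 p. 22] [claim: Mochizuki2012, status: disputed] -/
theorem _root_.Literature.IUT.LogVolume.Cor22.ThetaVolumeDatumAt.three_dvd_pow_inertiaDeg_sub_one (p : ℕ) [hp : Fact p.Prime]
    (hp3 : p ≠ 3) (v : letI := T.instFieldK; letI := T.instNumberFieldK; HeightOneSpectrum (𝓞 T.K))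
    (hv : letI := T.instFieldK; letI := T.instNumberFieldK; ((p : ℕ) : 𝓞 T.K) ∈ v.asIdeal) :
    3 ∣ p ^ (letI := T.instFieldK; letI := T.instNumberFieldK; v.asIdeal.inertiaDeg ℤ) - 1 := by
  letI := T.instFieldF; letI := T.instFieldK; letI := T.instNumberFieldK; letI := T.instAlgebraK
  obtain ⟨ζ, hζ⟩ := T.exists_isPrimitiveRoot_K Nat.prime_three (by norm_num)
  exact dvd_pow_inertiaDeg_sub_one_of_isPrimitiveRoot hζ p ((Nat.coprime_primes hp.out Nat.prime_three).mpr hp3) v hv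

/-- **`5 ∣ p^{f(𝔭∣p)} − 1` at every place of `K` over a prime `p ≠ 5`** (`ζ_5 ∈ K`). [cite: Washington1997, Thm. 2.13]
[cite: Mochizuki2012, IUTchIV Thm. 1.10 p. 22] [claim: Mochizuki2012, status: disputed] -/
theorem _root_.Literature.IUT.LogVolume.Cor22.ThetaVolumeDatumAt.five_dvd_pow_inertiaDeg_sub_one (p : ℕ) [hp : Fact p.Prime]
    (hp5 : p ≠ 5) (v : letI := T.instFieldK; letI := T.instNumberFieldK; HeightOneSpectrum (𝓞 T.K))
    (hv : letI := T.instFieldK; letI := T.instNumberFieldK; ((p : ℕ) : 𝓞 T.K) ∈ v.asIdeal) :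
    5 ∣ p ^ (letI := T.instFieldK; letI := T.instNumberFieldK; v.asIdeal.inertiaDeg ℤ) - 1 := by
  letI := T.instFieldF; letI := T.instFieldK; letI := T.instNumberFieldK; letI := T.instAlgebraK
  obtain ⟨ζ, hζ⟩ := T.exists_isPrimitiveRoot_K Nat.prime_five (by norm_num)
  exact dvd_pow_inertiaDeg_sub_one_of_isPrimitiveRoot hζ p ((Nat.coprime_primes hp.out Nat.prime_five).mpr hp5) v hv

/-- **THE RESIDUE-DEGREE LAW OF THE GENUINE BED.** At a genuine Θ-volume datum `T` (`X := pilotDataOfK T.D T.K`), for EVERY prime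
`p ≢ 1 (mod 60)` (the primes `2, 3, 5` included) and every fibre point `x` over `p`: `2 ∣ f(𝔭_x∣p)` and `f(𝔭_x∣p) ≥ 2` — from `√−1 ∈ K`
(`p ≡ 3 (mod 4)`), `ζ_3 ∈ K` (`p ≡ 2 (mod 3)`), `ζ_5 ∈ K` (`p ≡ 2, 3, 4 (mod 5)`). [cite: Mochizuki2012, IUTchI Def. 3.1 (a) p. 61;
IUTchIV Thm. 1.10 p. 22] [cite: Washington1997, Thm. 2.13] [cite: IrelandRosen1990, Ch. 7 §1 Thm. 1] [claim: Mochizuki2012, status: disputed] -/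
theorem _root_.Literature.IUT.LogVolume.Cor22.ThetaVolumeDatumAt.two_dvd_inertiaDeg_placeOf_of_mod_sixty_ne_one (pp : Nat.Primes)
    (h60 : (pp : ℕ) % 60 ≠ 1) :
    letI := T.instFieldF; letI := T.instNumberFieldF; letI := T.instAlgebraF; letI := T.instFieldK; letI := T.instNumberFieldK;
    letI := T.instAlgebraK; letI := T.instFieldFbar; letI := T.instAlgebraFbar; letI := T.instAlgebraKFbar; letI := T.instIsElliptic
    haveI : Fact (pp : ℕ).Prime := ⟨pp.2⟩
    ∀ x : (thetaIndex (pilotDataOfK T.D T.K)).Fibre (.inr pp),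
      2 ∣ (placeOf (pilotDataOfK T.D T.K) pp.1 x).asIdeal.inertiaDeg ℤ ∧ 2 ≤ (placeOf (pilotDataOfK T.D T.K) pp.1 x).asIdeal.inertiaDeg ℤ := by
  letI := T.instFieldF; letI := T.instNumberFieldF; letI := T.instAlgebraF; letI := T.instFieldK; letI := T.instNumberFieldK
  letI := T.instAlgebraK; letI := T.instFieldFbar; letI := T.instAlgebraFbar; letI := T.instAlgebraKFbar; letI := T.instIsElliptic
  haveI : Fact (pp : ℕ).Prime := ⟨pp.2⟩
  intro x
  have hmem := natCast_mem_placeOf (pilotDataOfK T.D T.K) pp.1 x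
  have hdvd : 2 ∣ (placeOf (pilotDataOfK T.D T.K) pp.1 x).asIdeal.inertiaDeg ℤ := by
    rcases prime_mod_cases pp.2 h60 with h4 | h3 | h5 | h5'
    · exact T.D.two_dvd_inertiaDeg_placeOf_of_mod_four_eq_three pp h4 x
    · exact two_dvd_of_three_dvd_pow_sub_one h3 (T.three_dvd_pow_inertiaDeg_sub_one pp.1 (by omega) _ hmem)
    · exact two_dvd_of_five_dvd_pow_sub_one h5 (T.five_dvd_pow_inertiaDeg_sub_one pp.1 (by omega) _ hmem)
    · exact (show (2 : ℕ) ∣ 4 by norm_num).trans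
        (four_dvd_of_five_dvd_pow_sub_one h5' (T.five_dvd_pow_inertiaDeg_sub_one pp.1 (by omega) _ hmem))
  haveI : (placeOf (pilotDataOfK T.D T.K) pp.1 x).asIdeal.IsMaximal := (placeOf (pilotDataOfK T.D T.K) pp.1 x).isMaximal
  exact ⟨hdvd, Nat.le_of_dvd (Ideal.inertiaDeg_pos _ ℤ) hdvd⟩

/-- … and `4 ∣ f(𝔭_x∣p)` over every prime `p ≡ 2, 3 (mod 5)`. [cite: Washington1997, Thm. 2.13] [claim: Mochizuki2012, status: disputed] -/
theorem _root_.Literature.IUT.LogVolume.Cor22.ThetaVolumeDatumAt.four_dvd_inertiaDeg_placeOf_of_mod_five (pp : Nat.Primes)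
    (h5 : (pp : ℕ) % 5 = 2 ∨ (pp : ℕ) % 5 = 3) :
    letI := T.instFieldF; letI := T.instNumberFieldF; letI := T.instAlgebraF; letI := T.instFieldK; letI := T.instNumberFieldK;
    letI := T.instAlgebraK; letI := T.instFieldFbar; letI := T.instAlgebraFbar; letI := T.instAlgebraKFbar; letI := T.instIsElliptic
    haveI : Fact (pp : ℕ).Prime := ⟨pp.2⟩
    ∀ x : (thetaIndex (pilotDataOfK T.D T.K)).Fibre (.inr pp), 4 ∣ (placeOf (pilotDataOfK T.D T.K) pp.1 x).asIdeal.inertiaDeg ℤ := by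
  letI := T.instFieldF; letI := T.instNumberFieldF; letI := T.instAlgebraF; letI := T.instFieldK; letI := T.instNumberFieldK
  letI := T.instAlgebraK; letI := T.instFieldFbar; letI := T.instAlgebraFbar; letI := T.instAlgebraKFbar; letI := T.instIsElliptic
  haveI : Fact (pp : ℕ).Prime := ⟨pp.2⟩
  intro x
  exact four_dvd_of_five_dvd_pow_sub_one h5
    (T.five_dvd_pow_inertiaDeg_sub_one pp.1 (by omega) _ (natCast_mem_placeOf (pilotDataOfK T.D T.K) pp.1 x))

/-- **A PLACE OF RESIDUE DEGREE `1` LIES OVER `p ≡ 1 (mod 60)`** (genuine Θ-volume datum). [cite: Mochizuki2012, IUTchI Def. 3.1 (a) p. 61;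
IUTchIV Thm. 1.10 p. 22] [cite: Washington1997, Thm. 2.13] [claim: Mochizuki2012, status: disputed] -/
theorem _root_.Literature.IUT.LogVolume.Cor22.ThetaVolumeDatumAt.mod_sixty_eq_one_of_inertiaDeg_eq_one (pp : Nat.Primes)
    (x : letI := T.instFieldF; letI := T.instNumberFieldF; letI := T.instAlgebraF; letI := T.instFieldK; letI := T.instNumberFieldK;
      letI := T.instAlgebraK; letI := T.instFieldFbar; letI := T.instAlgebraFbar; letI := T.instAlgebraKFbar; letI := T.instIsElliptic
      (thetaIndex (pilotDataOfK T.D T.K)).Fibre (.inr pp))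
    (hf : letI := T.instFieldF; letI := T.instNumberFieldF; letI := T.instAlgebraF; letI := T.instFieldK; letI := T.instNumberFieldK;
      letI := T.instAlgebraK; letI := T.instFieldFbar; letI := T.instAlgebraFbar; letI := T.instAlgebraKFbar; letI := T.instIsElliptic
      haveI : Fact (pp : ℕ).Prime := ⟨pp.2⟩
      (placeOf (pilotDataOfK T.D T.K) pp.1 x).asIdeal.inertiaDeg ℤ = 1) :
    (pp : ℕ) % 60 = 1 := by
  by_contra h60
  have h := (T.two_dvd_inertiaDeg_placeOf_of_mod_sixty_ne_one pp h60 x).2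
  omega

/-- **THE (O″)-SUPPLIER AT EVERY `p ≢ 1 (mod 60)`.** For ANY index `e`, the hypothesis-disjunction of the row-27 door
(`ReachLedgerDoor.statement_pilotDataOfK_of_hStarReachLedgerK_of_innerOuterUnit`, p483260) holds at such a prime by «`f ≥ 2`».
[cite: Mochizuki2012, IUTchI Def. 3.1 (a) p. 61; IUTchIV Thm. 1.10 p. 22] [cite: NeukirchANT1999, Ch. II (5.5)–(5.7)]
[claim: Mochizuki2012, status: disputed] -/
theorem _root_.Literature.IUT.LogVolume.Cor22.ThetaVolumeDatumAt.outerUnit_clause_of_mod_sixty_ne_one (pp : Nat.Primes)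
    (h60 : (pp : ℕ) % 60 ≠ 1) (e : ℕ) :
    letI := T.instFieldF; letI := T.instNumberFieldF; letI := T.instAlgebraF; letI := T.instFieldK; letI := T.instNumberFieldK;
    letI := T.instAlgebraK; letI := T.instFieldFbar; letI := T.instAlgebraFbar; letI := T.instAlgebraKFbar; letI := T.instIsElliptic
    haveI : Fact (pp : ℕ).Prime := ⟨pp.2⟩
    (∀ a : ℕ, (e : ℤ) ≠ ((pp : ℕ) : ℤ) ^ a * (((pp : ℕ) : ℤ) - 1)) ∨
      ∀ x : (thetaIndex (pilotDataOfK T.D T.K)).Fibre (.inr pp), 2 ≤ (placeOf (pilotDataOfK T.D T.K) pp.1 x).asIdeal.inertiaDeg ℤ ∨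
        ∃ π : kOf (pilotDataOfK T.D T.K) pp.1 x, ‖π‖ = ((pp : ℕ) : ℝ) ^ (-(1 : ℝ) / (e : ℝ)) ∧
          ‖1 + π ^ e / ((pp : ℕ) : kOf (pilotDataOfK T.D T.K) pp.1 x)‖ = 1 := by
  letI := T.instFieldF; letI := T.instNumberFieldF; letI := T.instAlgebraF; letI := T.instFieldK; letI := T.instNumberFieldK
  letI := T.instAlgebraK; letI := T.instFieldFbar; letI := T.instAlgebraFbar; letI := T.instAlgebraKFbar; letI := T.instIsElliptic
  exact Or.inr fun x => Or.inl (T.two_dvd_inertiaDeg_placeOf_of_mod_sixty_ne_one pp h60 x).2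

end Datum

end Summit.ABC.IUTFork.Repair.RH.TieDecider

end
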